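import Summits.BirchSwinnertonDyer.BirchSwinnertonDyer.Theorems.PrintCf2RamifiedOffTYZGeneratorDescent
import HarnessLib

/-!
# Route `PrintCf2`, crux stmt-BirchSwinnertonDyer-20509 `RamifiedOffTYZOfFacts` — GENERATOR DEPTH, part 2: THE `A_n`-GENERATOR `α_n` IS NEVER
# `4`-DIVISIBLE IN `A(ℍ′_n)` MODULO TORSION on the block-free family (law (D1′) of the R2 census as a THEOREM), in both currencies of the line
# (cell `bsd-print-cf2`, LEAD of 20509 g18, line `offtyz-v7`, lineage cycle 19; fact-free, Theses-free, no `def`)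

HONEST FRAMING (crux 20509 = `𝔅_ram → WAllCornerFTwoRamifiedOffTYZProved`, DECIDING, OPEN AS A CLASS; C⁺ = `stub_offTYZ_levelTwoScriptLExact`
= item stmt-BirchSwinnertonDyer-23431, OPEN).  Pure `2`-descent / Galois algebra on the tree's objects (`A = curveA`, `Θ_A`, `Θ_E`, `φ_H`, the W2
index lemma `stub_S1`, the displayed field `ℍ′_n` of `D : GenusPointData n`) with TYZ's **Lemma 3.18** (`A(ℍ′_n)_tor ⊆ A[(1+i)³]`, odd `n`) taken
as the displayed HYPOTHESIS `D.lemma318` and a COMMUTATIVE `Gal(ℍ′_n/ℚ)` as a hypothesis (`hcomm`; on the block-free family `n ≡ 7 (mod 8)`, every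
prime `≡ ±1 (mod 8)`, it is the compositum display `CMPointCompositumPrinted`, `CompositumSpec.commute_of_noBlock`, g16).  Nothing is asserted;
no named fact is introduced; no BSD / GZK in §2–§3.

THE LEAD g17 instrument census (`Cruxes/RamifiedOffTYZOfFacts/Lines/offtyz_v7_GenusPeriodBit.md` §11; 122 members `n = lq ≤ 2·10⁴` of the
block-free `k = 2` sector R2) found, with 0 exceptions, the law (D1′) «`depth_{A(ℍ′_n)/tors}(α_n) ∈ {0, 1}`» for the generator `α_n` of the free
part of `A(K_n)⁻` — the GENERATOR side of the depth comparison `v₂(𝓛(n)) = ρ(n) + 1 + depth P(n) − depth α_n` (`…LevelTwoDepth`) that C⁺ is.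
THIS FILE PROVES IT for every block-free `n` (all `k`):

* §2 `not_fourDivisible_map_ΘA` — **square-free odd `n > 1`, `D.lemma318`, `Gal(ℍ′_n/ℚ)` commutative, `α₀` a generator of `A_n(ℚ)` modulo
  torsion of infinite order ⟹ `ι Θ_A(α₀) ∉ 4A(ℍ′_n) + A(ℍ′_n)_tor`.**  MECHANISM (an `H¹` of exponent two): if `4y = α + t` then
  `g ↦ g·y − χ_n(g)·y` is a TORSION-valued cocycle; commuting `g` with ONE `g₀` (`g₀(i) = i`, `g₀(√−n) = −√−n`, part 1) against the `i`-fixing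
  `√−n`-fixing `σ` (which fix all torsion, Lemma 3.18 + `galPt_eq_self_of_isOfFinAddOrder`) kills the DOUBLE of the cocycle on `Gal(ℍ′_n/K_n(i))`;
  by Lemma 3.18 the double takes values in `{0, τ(1)}` and is then the twisted coboundary of `T⁺ = (2i, 0)` and/or `τ(1/2) = (2, 4)`; so
  `2y − t₀` is `χ_n`-equivariant, hence (DESCENT, part 1) `= ι Θ_A(P)`, `P ≡ m·α₀`, and `4y = α + t` gives `(1 − 2m)·α` torsion — absurd.
* §3 the bound in the line's two currencies: `not_fourDivisible_generator` (any generator `α` of the free part of `A(K_n)⁻`, g0/g2's `α`);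
  `not_fourDivisible_pow_smul_half` (`2^ρ·Q₁ ∉ 4A + tors` for any half `Q₁` of the twisted Mordell–Weil generator, `2^ρ = [E_n(ℚ) : φ_n(A_n(ℚ)) +
  E_n[2]]`, via the valve file's half relation `ι Θ_A(α₀) ≡ ±2^ρ·Q₁`); hence **`half_not_twoDivisible_of_rhoIndex_eq_two`: `ρ(n) = 1 ⟹
  [Q₁] ≠ 0` — on the block-free family the half of the Mordell–Weil generator is VISIBLE whenever `ρ = 1`** (with the valve: `depth α_n = 1`
  exactly), and `half_not_fourDivisible_of_rhoIndex_eq_one` (`ρ = 0 ⟹ depth Q₁ = depth α_n ≤ 1`).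

What this buys the line (LEAD census, crux 20509): on the block-free family the GENERATOR side of C⁺ is now COMPUTED by theorems —
`depth Q₁ = [ρ(n) = 0 ∧ [α_n] = 0] ∈ {0, 1}` — so BOTH halves of C⁺ there are statements about the genus point `P(n)` ALONE
(part 3: the lower half at `ρ = 1` with no Selmer hypothesis; C⁺ at `ρ = 1` ⟺ `[P(n)] ≠ 0`; on the invisible special stratum lower half ⟺
`[P(n)] = 0`, upper half ⟺ `P(n) ∉ 4A + tors`).  With blocks (`n ≡ 5 (mod 8)`, or a divisor `≡ 5`) `Gal(ℍ′_n/ℚ)` is generalised dihedral on the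
ring class part and the exponent-two argument fails (order-`4` cocycles into `A[(1+i)³]` on `2Cl′_d` are not excluded): untouched.
Beyond-print theorem: YES, modestly (a descent theorem the source does not state; conditional only on the displayed Lemma 3.18 and the
compositum sentence).  BSD is not proved by any of this; C⁺ / crux 20509 stay OPEN; no class is closed by this file.

References: [cite: TianYuanZhang2017, §1 (arXiv:1411.4728 chunk p0002 L101–L110: `ρ(n)`, `φ_n`), §3.1 (p0011 L27–L36: `A(K_n)⁻`, `α_n`;
p0011 L58–L66: `ℍ′_n := L_n(i)·∏ H′_{d₀}`), Prop. 3.2 (3) (p0010 L112), Thm. 3.5 (p0011 L94–L100), Lemma 3.16 (p0017 L98–L113),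
Lemma 3.18 (p0017 L152–L153)]; [cite: SilvermanAEC2009, Prop. X.4.9, X.5 Cor. 5.4]; [cite: Darmon2004, Thm. 3.22] (GZK, binder `hGZK`);
[cite: Lang2002, VI §1 Thm. 1.2, Cor. 1.4]; tree: `…LevelTwoRhoValve` (g3), `…LevelTwoHalves` / `…LevelTwoGenusQuotient` (g11),
`…LevelTwoDepth` (g3), `…VisibleGenerator` / `…LowerHalfVisibleSeven` / `TianYuanZhang2017/CMPointCompositumDisplays` (g16),
`TianYuanZhang2017/GenusDescent{Defs,Twist,EnSide}` (W2 kernel), LEAD memo `Cruxes/RamifiedOffTYZOfFacts/Lines/offtyz_v7_GeneratorDepth.md`.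
-/

noncomputable section

open scoped Classical

open WeierstrassCurve WeierstrassCurve.Affine WeierstrassCurve.Affine.Point
  Literature.NumberTheory.EllipticCurves Literature.NumberTheory.EllipticCurves.Rank1Residual
  Summit.BirchSwinnertonDyer.Rank1Residual
  Literature.NumberTheory.EllipticCurves.TianYuanZhang2017
  Literature.NumberTheory.EllipticCurves.TianYuanZhang2017.W2
  Summit.BirchSwinnertonDyer.PrintCf2.GaloisMotion
  Summit.BirchSwinnertonDyer.Rank1Residual.P2.ThetaDescent
  Summit.BirchSwinnertonDyer.PrintCf2.LowerHalfVisible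

set_option autoImplicit false

namespace Summit.BirchSwinnertonDyer.PrintCf2.GeneratorDepth

variable {n : ℕ}

/-! ## §2 The core theorem: on the block-free family `α_n` is never `4`-divisible in `A(ℍ′_n)` modulo torsion -/

section Helpers

variable {G : Type*} [AddCommGroup G]

/-- `a, b` of finite order ⟹ `a − b` of finite order. [folklore] -/
private theorem isOfFinAddOrder_sub {a b : G} (ha : IsOfFinAddOrder a) (hb : IsOfFinAddOrder b) :
    IsOfFinAddOrder (a - b) := by
  rw [sub_eq_add_neg]; exact ha.add hb.neg

end Helpers

/-- `(gh)·Q = g·(h·Q)`. [cite: TianYuanZhang2017, proof of Lemma 3.21 (p0020 L55–L62)] -/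
private theorem galPt_mul' (D : GenusPointData n) (g h : D.H ≃ₐ[ℚ] D.H) (Q : APoint D.H) :
    D.galPt (g * h) Q = D.galPt g (D.galPt h Q) :=
  Summit.BirchSwinnertonDyer.Rank1Residual.P2.GenusPeriodTransferLayer.galPt_mul D g h Q

/-- `g x = x ⟹ g⁻¹ x = x`. [folklore] -/
private theorem inv_apply_of_apply_eq (D : GenusPointData n) {g : D.H ≃ₐ[ℚ] D.H} {x : D.H} (h : g x = x) : g⁻¹ x = x := by
  have e : g⁻¹ (g x) = x := by rw [← AlgEquiv.mul_apply, inv_mul_cancel, AlgEquiv.one_apply]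
  rwa [h] at e

/-- `g x = −x ⟹ g⁻¹ x = −x`. [folklore] -/
private theorem inv_apply_of_apply_eq_neg (D : GenusPointData n) {g : D.H ≃ₐ[ℚ] D.H} {x : D.H} (h : g x = -x) :
    g⁻¹ x = -x := by
  have e : g⁻¹ (g x) = x := by rw [← AlgEquiv.mul_apply, inv_mul_cancel, AlgEquiv.one_apply]
  rw [h, map_neg] at e
  linear_combination -e

/-- `T⁺ = (2i, 0)` is killed by `2`. [cite: TianYuanZhang2017, §3.2 (p0012 L12–L18)] -/
private theorem two_nsmul_tPlus (D : GenusPointData n) : (2 : ℕ) • (tPlus D.im D.im_sq : APoint D.H) = 0 := by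
  rw [two_nsmul, tPlus]; exact Point.add_of_Y_eq rfl (by simp [negY])

/-- An automorphism fixing `i` fixes `T⁺ = (2i, 0)`. [cite: TianYuanZhang2017, §3.2 (p0012 L12–L18)] -/
private theorem galPt_tPlus_of_fix (D : GenusPointData n) (g : D.H ≃ₐ[ℚ] D.H) (hgi : g D.im = D.im) :
    D.galPt g (tPlus D.im D.im_sq) = tPlus D.im D.im_sq :=
  galPt_some_eq_of_fixed D g _ (by rw [map_mul, map_ofNat, hgi]) (map_zero g)

/-- An automorphism flipping `i` moves `T⁺ = (2i, 0)` by `τ(1)`. [cite: TianYuanZhang2017, §3.2 (p0012 L12–L18)] -/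
private theorem galPt_tPlus_of_flip (D : GenusPointData n) (g : D.H ≃ₐ[ℚ] D.H) (hgi : g D.im = -D.im) :
    D.galPt g (tPlus D.im D.im_sq) = tPlus D.im D.im_sq + tauOne := by
  have h := (map_sub_tPlus_tMinus (g : D.H →ₐ[ℚ] D.H) D.im D.im_sq hgi).1
  change D.galPt g (tPlus D.im D.im_sq) - tPlus D.im D.im_sq = tauOne at h
  rw [sub_eq_iff_eq_add'] at h
  rw [h, add_comm]

/-- **THE GENERATOR HAS DEPTH AT MOST ONE — CENTRAL-`g₀` FORM.**  Square-free odd `n`; data `D : GenusPointData n` with Lemma 3.18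
(`A(ℍ′_n)_tor ⊆ A[(1+i)³]`); an automorphism `g₀` of `ℍ′_n` with `g₀(i) = i`, `g₀(√−n) = −√−n` that COMMUTES with every automorphism fixing `i`
and `√−n` (automatic when `Gal(ℍ′_n/ℚ)` is commutative — the block-free family, next theorem; with blocks it is a class-field-theoretic
condition on `n`); `α₀` a generator of `A_n(ℚ)` modulo torsion, of infinite order.  Then **`ι Θ_A(α₀) ∉ 4·A(ℍ′_n) + A(ℍ′_n)_tor`**: the point
`α_n` of Thm. 3.5 has `2`-adic depth `≤ 1` in `A(ℍ′_n)/tors`.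
MECHANISM (an `H¹` of exponent `2`): if `4y = α + t`, the cocycle `g ↦ g·y − χ_n(g)·y` is torsion-valued; commuting `g₀` with the `i`-fixing
`√−n`-fixing `σ` (which fix all torsion) kills its double on `Gal(ℍ′_n/K_n(i))`; the double is then a homomorphism to `{0, τ(1)}` through
`Gal(ℚ(i, √−n)/ℚ)`, i.e. the twisted coboundary of `T⁺ = (2i,0)` and/or `τ(1/2) = (2,4)`; so `2y − t₀` is `χ_n`-EQUIVARIANT, hence (descent,
part 1) in `ι Θ_A(A_n(ℚ)) = ℤ·α + tors`, and `4y = α + t` gives `(1 − 2m)·α` torsion — absurd.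
[cite: TianYuanZhang2017, §3.1 (p0011 L27–L36, L58–L66), Prop. 3.2 (3) (p0010 L112), Lemma 3.16 (p0017 L98–L113), Lemma 3.18 (p0017 L152–L153)]
[cite: SilvermanAEC2009, X.5 Cor. 5.4] [cite: Lang2002, VI §1 Thm. 1.2, Cor. 1.4] -/
theorem not_fourDivisible_map_ΘA_of_central (hsq : Squarefree n) (hodd : Odd n) (D : GenusPointData n)
    (h318 : D.lemma318) {g₀ : D.H ≃ₐ[ℚ] D.H} (hg₀i : g₀ D.im = D.im) (hg₀K : g₀ (D.sqrtNeg n) = -D.sqrtNeg n)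
    (hg₀c : ∀ σ : D.H ≃ₐ[ℚ] D.H, σ D.im = D.im → σ (D.sqrtNeg n) = D.sqrtNeg n → g₀ * σ = σ * g₀)
    {α₀ : (Atwo n).toAffine.Point} (hgen : ∀ P : (Atwo n).toAffine.Point, ∃ m : ℤ, IsOfFinAddOrder (P - m • α₀))
    (hα : ¬ IsOfFinAddOrder α₀) :
    ¬ ∃ y : APoint D.H, IsOfFinAddOrder
      (Point.map (W' := curveA) (D.embK n (Nat.mem_divisors_self n hsq.ne_zero)) (ΘA hsq.ne_zero α₀) - (4 : ℤ) • y) := by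
  have hn0 : n ≠ 0 := hsq.ne_zero
  have hn : n ∈ n.divisors := Nat.mem_divisors_self n hn0
  rintro ⟨y, hy⟩
  set a : APoint D.H := Point.map (W' := curveA) (D.embK n hn) (ΘA hn0 α₀) with ha_def
  have ha_fix : ∀ g : D.H ≃ₐ[ℚ] D.H, g (D.sqrtNeg n) = D.sqrtNeg n → D.galPt g a = a :=
    fun g hg => galPt_map_ΘA_of_fix hsq D g hg α₀
  have ha_flip : ∀ g : D.H ≃ₐ[ℚ] D.H, g (D.sqrtNeg n) = -D.sqrtNeg n → D.galPt g a = -a :=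
    fun g hg => galPt_map_ΘA_of_flip hsq D g hg α₀
  -- the torsion point `t := 4y − α`
  set t : APoint D.H := (4 : ℤ) • y - a with ht_def
  have ht : IsOfFinAddOrder t := by
    have h := hy.neg
    rwa [neg_sub] at h
  have h4y : (4 : ℤ) • y = a + t := by rw [ht_def]; abel
  have htor_fix : ∀ (g : D.H ≃ₐ[ℚ] D.H), g D.im = D.im → ∀ {t' : APoint D.H}, IsOfFinAddOrder t' → D.galPt g t' = t' :=
    fun g hgi _ ht' => galPt_eq_self_of_isOfFinAddOrder D hodd h318 g hgi ht'
  have h4ne : (4 : ℤ) ≠ 0 := by norm_num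
  -- the cocycle is torsion-valued
  have hc_fix : ∀ g : D.H ≃ₐ[ℚ] D.H, g (D.sqrtNeg n) = D.sqrtNeg n → IsOfFinAddOrder (D.galPt g y - y) := by
    intro g hg
    have e : (4 : ℤ) • (D.galPt g y - y) = D.galPt g t - t := by
      rw [smul_sub, ← map_zsmul, h4y, map_add, ha_fix g hg]; abel
    exact LevelTwo.isOfFinAddOrder_of_zsmul h4ne (by rw [e]; exact isOfFinAddOrder_sub ((D.galPt g).isOfFinAddOrder ht) ht)
  have hc_flip : ∀ g : D.H ≃ₐ[ℚ] D.H, g (D.sqrtNeg n) = -D.sqrtNeg n → IsOfFinAddOrder (D.galPt g y + y) := by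
    intro g hg
    have e : (4 : ℤ) • (D.galPt g y + y) = D.galPt g t + t := by
      rw [smul_add, ← map_zsmul, h4y, map_add, ha_flip g hg]; abel
    exact LevelTwo.isOfFinAddOrder_of_zsmul h4ne (by rw [e]; exact ((D.galPt g).isOfFinAddOrder ht).add ht)
  -- the automorphism `g₀` fixing `i` and flipping `√−n`
  have hg₀K' : g₀⁻¹ (D.sqrtNeg n) = -D.sqrtNeg n := inv_apply_of_apply_eq_neg D hg₀K
  set c₀ : APoint D.H := D.galPt g₀ y + y with hc₀_def
  have hc₀ : IsOfFinAddOrder c₀ := hc_flip g₀ hg₀K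
  have hg₀y : D.galPt g₀ y = c₀ - y := by rw [hc₀_def]; abel
  -- `y₁ := 2y`
  set y₁ : APoint D.H := (2 : ℤ) • y with hy₁_def
  -- STEP A: automorphisms fixing `i` and `√−n` fix `y₁`
  have hA : ∀ σ : D.H ≃ₐ[ℚ] D.H, σ D.im = D.im → σ (D.sqrtNeg n) = D.sqrtNeg n → D.galPt σ y₁ = y₁ := by
    intro σ hσi hσK
    set cσ : APoint D.H := D.galPt σ y - y with hcσ_def
    have hcσ : IsOfFinAddOrder cσ := hc_fix σ hσK
    have hσy : D.galPt σ y = y + cσ := by rw [hcσ_def]; abel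
    have e1 : D.galPt g₀ (D.galPt σ y) = D.galPt σ (D.galPt g₀ y) := by
      rw [← galPt_mul', ← galPt_mul', hg₀c σ hσi hσK]
    have lhs : D.galPt g₀ (D.galPt σ y) = c₀ - y + cσ := by
      rw [hσy, map_add, htor_fix g₀ hg₀i hcσ, hg₀y]
    have rhs : D.galPt σ (D.galPt g₀ y) = c₀ - (y + cσ) := by
      rw [hg₀y, map_sub, htor_fix σ hσi hc₀, hσy]
    have h2 : cσ + cσ = 0 := by
      calc cσ + cσ = (c₀ - y + cσ) - (c₀ - (y + cσ)) := by abel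
        _ = 0 := by rw [← lhs, ← rhs, e1, sub_self]
    calc D.galPt σ y₁ = D.galPt σ y + D.galPt σ y := by rw [hy₁_def, two_zsmul, map_add]
      _ = y₁ + (cσ + cσ) := by rw [hσy, hy₁_def, two_zsmul]; abel
      _ = y₁ := by rw [h2, add_zero]
  -- the values of the doubled cocycle on `K_n`-fixing automorphisms lie in `{0, τ(1)}`
  have hδ : ∀ g : D.H ≃ₐ[ℚ] D.H, g (D.sqrtNeg n) = D.sqrtNeg n →
      D.galPt g y₁ - y₁ = 0 ∨ D.galPt g y₁ - y₁ = tauOne := by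
    intro g hg
    have e : D.galPt g y₁ - y₁ = (2 : ℕ) • (D.galPt g y - y) := by
      rw [hy₁_def, map_zsmul, ← smul_sub, two_zsmul, two_nsmul]
    rw [e]
    exact (h318.1 hodd _ (hc_fix g hg)).2
  -- STEP B: correct by `T⁺` so that ALL `K_n`-fixing automorphisms fix the point
  have hB : ∃ y₂ : APoint D.H, (2 : ℕ) • (y₂ - y₁) = 0 ∧
      ∀ g : D.H ≃ₐ[ℚ] D.H, g (D.sqrtNeg n) = D.sqrtNeg n → D.galPt g y₂ = y₂ := by
    by_cases hW : ∃ g₁ : D.H ≃ₐ[ℚ] D.H, g₁ D.im = -D.im ∧ g₁ (D.sqrtNeg n) = D.sqrtNeg n ∧ D.galPt g₁ y₁ - y₁ = tauOne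
    · obtain ⟨g₁, hg₁i, hg₁K, hg₁y⟩ := hW
      refine ⟨y₁ - tPlus D.im D.im_sq, ?_, fun g hgK => ?_⟩
      · rw [sub_sub_cancel_left, smul_neg, two_nsmul_tPlus, _root_.neg_zero]
      · rcases apply_im_eq_or D g with hgi | hgi
        · rw [map_sub, hA g hgi hgK, galPt_tPlus_of_fix D g hgi]
        · -- `g = g₁ h` with `h` fixing `i` and `√−n`
          have hhi : (g₁⁻¹ * g) D.im = D.im := by
            rw [AlgEquiv.mul_apply, hgi, map_neg, inv_apply_of_apply_eq_neg D hg₁i, neg_neg]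
          have hhK : (g₁⁻¹ * g) (D.sqrtNeg n) = D.sqrtNeg n := by
            rw [AlgEquiv.mul_apply, hgK, inv_apply_of_apply_eq D hg₁K]
          have hgy₁ : D.galPt g y₁ = y₁ + tauOne := by
            have e : g = g₁ * (g₁⁻¹ * g) := by group
            rw [e, galPt_mul', hA _ hhi hhK, ← sub_eq_iff_eq_add', hg₁y]
          rw [map_sub, hgy₁, galPt_tPlus_of_flip D g hgi]; abel
    · refine ⟨y₁, by rw [sub_self, smul_zero], fun g hgK => ?_⟩
      rcases apply_im_eq_or D g with hgi | hgi
      · exact hA g hgi hgK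
      · rcases hδ g hgK with h0 | h1
        · exact sub_eq_zero.mp h0
        · exact absurd ⟨g, hgi, hgK, h1⟩ hW
  obtain ⟨y₂, hy₂, hBfix⟩ := hB
  -- STEP C: correct by `τ(1/2)` so that the `K_n`-flipping automorphisms negate the point
  have hy₂tor : IsOfFinAddOrder (y₂ - y₁) := isOfFinAddOrder_iff_nsmul_eq_zero.mpr ⟨2, two_pos, hy₂⟩
  set d₀ : APoint D.H := D.galPt g₀ y₂ + y₂ with hd₀_def
  have hd₀ : d₀ = 0 ∨ d₀ = tauOne := by
    have hr : D.galPt g₀ (y₂ - y₁) = y₂ - y₁ := htor_fix g₀ hg₀i hy₂tor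
    have e1 : D.galPt g₀ y₂ = D.galPt g₀ y₁ + (y₂ - y₁) := by
      rw [← hr, ← map_add]; congr 1; abel
    have e2 : D.galPt g₀ y₁ = (2 : ℕ) • c₀ - y₁ := by
      rw [hy₁_def, map_zsmul, hg₀y, smul_sub, two_zsmul, two_zsmul, two_nsmul]
    have e : d₀ = (2 : ℕ) • c₀ := by
      calc d₀ = D.galPt g₀ y₂ + y₂ := hd₀_def
        _ = (2 : ℕ) • c₀ + ((y₂ - y₁) + (y₂ - y₁)) := by rw [e1, e2]; abel
        _ = (2 : ℕ) • c₀ := by rw [← two_nsmul, hy₂, add_zero]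
    rw [e]
    exact (h318.1 hodd _ hc₀).2
  have hflip_y₂ : ∀ g : D.H ≃ₐ[ℚ] D.H, g (D.sqrtNeg n) = -D.sqrtNeg n → D.galPt g y₂ = d₀ - y₂ := by
    intro g hgK
    have hhK : (g₀⁻¹ * g) (D.sqrtNeg n) = D.sqrtNeg n := by
      rw [AlgEquiv.mul_apply, hgK, map_neg, hg₀K', neg_neg]
    have e : g = g₀ * (g₀⁻¹ * g) := by group
    rw [e, galPt_mul', hBfix _ hhK, hd₀_def]; abel
  have hC : ∃ y₃ : APoint D.H, IsOfFinAddOrder (y₃ - y₁) ∧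
      (∀ g : D.H ≃ₐ[ℚ] D.H, g (D.sqrtNeg n) = D.sqrtNeg n → D.galPt g y₃ = y₃) ∧
      (∀ g : D.H ≃ₐ[ℚ] D.H, g (D.sqrtNeg n) = -D.sqrtNeg n → D.galPt g y₃ = -y₃) := by
    rcases hd₀ with h0 | h1
    · exact ⟨y₂, hy₂tor, hBfix, fun g hgK => by rw [hflip_y₂ g hgK, h0, zero_sub]⟩
    · have htH : IsOfFinAddOrder (tauHalf : APoint D.H) := by
        refine isOfFinAddOrder_iff_nsmul_eq_zero.mpr ⟨4, by norm_num, ?_⟩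
        rw [show (4 : ℕ) = 2 * 2 from rfl, mul_nsmul, two_nsmul_tauHalf, two_nsmul_tauOne]
      refine ⟨y₂ - tauHalf, by rw [sub_right_comm]; exact isOfFinAddOrder_sub hy₂tor htH, fun g hgK => ?_, fun g hgK => ?_⟩
      · rw [map_sub, hBfix g hgK, (LevelTwoGenusQuotient.galPt_tauHalf D g).1]
      · rw [map_sub, hflip_y₂ g hgK, (LevelTwoGenusQuotient.galPt_tauHalf D g).1, h1, ← two_nsmul_tauHalf, two_nsmul]
        abel
  -- STEP D: descent and the contradiction
  obtain ⟨y₃, hy₃, hfix₃, hflip₃⟩ := hC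
  obtain ⟨P, hP⟩ := exists_map_ΘA_eq_of_twisted hsq D y₃ hfix₃ hflip₃
  obtain ⟨m, hm⟩ := hgen P
  have hPa : IsOfFinAddOrder (y₃ - m • a) := by
    have h := (Point.map (W' := curveA) (D.embK n hn)).isOfFinAddOrder ((ΘA hn0).isOfFinAddOrder hm)
    rwa [map_sub, map_zsmul, map_sub, map_zsmul, hP] at h
  -- `2y₁ = 4y = a + t`, so `(1 − 2m)·a` is torsion
  have hkey : IsOfFinAddOrder ((1 - 2 * m) • a) := by
    have e : (1 - 2 * m) • a = (2 : ℤ) • ((y₃ - m • a) - (y₃ - y₁)) - t := by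
      rw [sub_sub_sub_cancel_left, smul_sub, smul_smul, smul_smul, show (2 : ℤ) * 2 = 4 by norm_num, h4y,
        sub_smul, one_smul]
      abel
    rw [e]
    exact isOfFinAddOrder_sub (isOfFinAddOrder_sub hPa hy₃).zsmul ht
  have hodd1 : (1 - 2 * m : ℤ) ≠ 0 := by omega
  have ha_tor : IsOfFinAddOrder a := LevelTwo.isOfFinAddOrder_of_zsmul hodd1 hkey
  have hΘ : IsOfFinAddOrder (ΘA hn0 α₀) :=
    ((Point.map_injective (W' := curveA) (f := D.embK n hn)).isOfFinAddOrder_iff).mp ha_tor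
  exact hα (isOfFinAddOrder_of_ΘA hn0 α₀ hΘ)

/-- **THE GENERATOR HAS DEPTH AT MOST ONE (block-free family).**  Square-free odd `n > 1`; data `D : GenusPointData n` with Lemma 3.18 and a
COMMUTATIVE `Gal(ℍ′_n/ℚ)` (the block-free family `n ≡ 7 (mod 8)`, every prime factor `≡ ±1 (mod 8)`, where `ℍ′_n = L_n(i)` is multiquadratic
by the compositum display `CompositumSpec.commute_of_noBlock`); `α₀` a generator of `A_n(ℚ)` modulo torsion, of infinite order.  Then
**`ι Θ_A(α₀) ∉ 4·A(ℍ′_n) + A(ℍ′_n)_tor`** (the central `g₀` exists by `exists_algEquiv_im_eq_sqrtNeg_eq_neg`, part 1).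
[cite: TianYuanZhang2017, §3.1 (p0011 L27–L36, L58–L66), Prop. 3.2 (3) (p0010 L112), Lemma 3.18 (p0017 L152–L153)] [cite: Lang2002, VI §1 Cor. 1.4] -/
theorem not_fourDivisible_map_ΘA (hsq : Squarefree n) (hodd : Odd n) (hn1 : 1 < n) (D : GenusPointData n)
    (h318 : D.lemma318) (hcomm : ∀ g h : D.H ≃ₐ[ℚ] D.H, g * h = h * g)
    {α₀ : (Atwo n).toAffine.Point} (hgen : ∀ P : (Atwo n).toAffine.Point, ∃ m : ℤ, IsOfFinAddOrder (P - m • α₀))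
    (hα : ¬ IsOfFinAddOrder α₀) :
    ¬ ∃ y : APoint D.H, IsOfFinAddOrder
      (Point.map (W' := curveA) (D.embK n (Nat.mem_divisors_self n hsq.ne_zero)) (ΘA hsq.ne_zero α₀) - (4 : ℤ) • y) := by
  obtain ⟨g₀, hg₀i, hg₀K⟩ := exists_algEquiv_im_eq_sqrtNeg_eq_neg D hsq hn1
  exact not_fourDivisible_map_ΘA_of_central hsq hodd D h318 hg₀i hg₀K (fun σ _ _ => hcomm g₀ σ) hgen hα


/-! ## §3 The same bound in the two currencies of the line: `α ∈ A(K_n)⁻` generating the free part, and the half `Q₁` of the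
Mordell–Weil generator of `E_n(ℚ)` -/

/-- **`α_n ∉ 4A(ℍ′_n) + tors`** for ANY generator `α` of the free part of `A(K_n)⁻` of infinite order (block-free family; hypotheses as
in `not_fourDivisible_map_ΘA`). [cite: TianYuanZhang2017, §3.1 (p0011 L27–L36), Thm. 3.5 (p0011 L94–L95), Lemma 3.18 (p0017 L152–L153)] -/
theorem not_fourDivisible_generator (hsq : Squarefree n) (hodd : Odd n) (hn1 : 1 < n) (D : GenusPointData n)
    (h318 : D.lemma318) (hcomm : ∀ g h : D.H ≃ₐ[ℚ] D.H, g * h = h * g)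
    {α : APoint (GenusField n)} (hα : GeneratesFreePart n α) (hαnt : ¬ IsOfFinAddOrder α) :
    ¬ ∃ y : APoint D.H, IsOfFinAddOrder
      (Point.map (W' := curveA) (D.embK n (Nat.mem_divisors_self n hsq.ne_zero)) α - (4 : ℤ) • y) := by
  have hn0 : n ≠ 0 := hsq.ne_zero
  obtain ⟨P, rfl⟩ := exists_ΘA_eq hn0 α hα.1
  have hgen : ∀ P' : (Atwo n).toAffine.Point, ∃ m : ℤ, IsOfFinAddOrder (P' - m • P) := by
    intro P'
    obtain ⟨m, hm⟩ := hα.2 (ΘA hn0 P') (map_conj_ΘA hn0 P')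
    refine ⟨m, isOfFinAddOrder_of_ΘA hn0 _ ?_⟩
    rwa [map_sub, map_zsmul]
  have hPnt : ¬ IsOfFinAddOrder P := fun h => hαnt ((ΘA hn0).isOfFinAddOrder h)
  exact not_fourDivisible_map_ΘA hsq hodd hn1 D h318 hcomm hgen hPnt

/-- **`2^ρ·Q₁ ∉ 4A(ℍ′_n) + tors`** for any half `Q₁` (`φ_H(Q₁) = ι Θ_E(R)`) of the Mordell–Weil generator `R` of `E_n(ℚ)` (rank one) and
`2^ρ = [E_n(ℚ) : φ_n(A_n(ℚ)) + E_n[2]]` — block-free family (`ι Θ_A(α₀) ≡ ±2^ρ·Q₁`, the half relation of the valve file).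
[cite: TianYuanZhang2017, §1 (p0002 L101–L110), §3.1 (p0011 L27–L36), Lemma 3.18 (p0017 L152–L153)] [cite: SilvermanAEC2009, Prop. X.4.9] -/
theorem not_fourDivisible_pow_smul_half (hsq : Squarefree n) (hodd : Odd n) (hn1 : 1 < n) (D : GenusPointData n)
    (h318 : D.lemma318) (hcomm : ∀ g h : D.H ≃ₐ[ℚ] D.H, g * h = h * g)
    (hrank : haveI := isElliptic_congruentNumberCurve hsq.ne_zero; (congruentNumberCurve n).mordellWeilRank = 1)
    {ρ : ℕ} (hρ : (rhoSubgroup n).index = 2 ^ ρ)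
    {R : (congruentNumberCurve n).toAffine.Point} (hR : ∀ x, ∃ k : ℤ, IsOfFinAddOrder (x - k • R))
    {Q₁ : APoint D.H} (hQ₁ : φH D Q₁ = Point.map (W' := curveA.twoIsogenyCodomain)
      (D.embK n (Nat.mem_divisors_self n hsq.ne_zero)) (ΘE hsq.ne_zero R)) :
    ¬ ∃ y : APoint D.H, IsOfFinAddOrder (((2 : ℤ) ^ ρ) • Q₁ - (4 : ℤ) • y) := by
  haveI := isElliptic_congruentNumberCurve hsq.ne_zero
  have hn0 : n ≠ 0 := hsq.ne_zero
  obtain ⟨α₀, hα₀⟩ := stub_S0' (n := n) hrank.le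
  have hrank2 : 1 ≤ (Atwo n).mordellWeilRank := by
    rw [← (congruentNumberCurve n).twoIsogeny.mordellWeilRank_eq, hrank]
  obtain ⟨x, hx⟩ := LevelTwo.exists_not_isOfFinAddOrder_of_one_le_rank (Atwo n) hrank2
  have hα₀nt : ¬ IsOfFinAddOrder α₀ := LevelTwo.not_isOfFinAddOrder_of_generates hx (hα₀ x)
  obtain ⟨ε, hε, t₂, ht₂, hψα⟩ := stub_S1 hsq (ψQ n) xSqClass_eq_one_iff_exists_ψQ hρ hR hα₀
  have key := LevelTwoRhoValve.map_ΘA_sub_zsmul_half_isOfFinAddOrder hsq D ht₂ hψα hQ₁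
  rintro ⟨y, hy⟩
  refine not_fourDivisible_map_ΘA hsq hodd hn1 D h318 hcomm hα₀ hα₀nt ⟨ε • y, ?_⟩
  have e : Point.map (W' := curveA) (D.embK n (Nat.mem_divisors_self n hsq.ne_zero)) (ΘA hn0 α₀) - (4 : ℤ) • (ε • y) =
      (Point.map (W' := curveA) (D.embK n (Nat.mem_divisors_self n hsq.ne_zero)) (ΘA hn0 α₀) - (ε * 2 ^ ρ) • Q₁) +
        ε • (((2 : ℤ) ^ ρ) • Q₁ - (4 : ℤ) • y) := by
    rw [smul_sub, smul_smul, smul_smul, smul_smul, mul_comm (4 : ℤ) ε]; abel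
  rw [e]
  exact key.add hy.zsmul

/-- **`ρ(n) = 1` ⟹ THE HALF IS VISIBLE: `Q₁ ∉ 2A(ℍ′_n) + tors`** (block-free family, rank one).  With the valve
(`…LevelTwoRhoValve`: `ρ ≥ 1` ⟹ `α_n ∈ 2A + tors`) this says `depth(α_n) = 1` EXACTLY and `depth(Q₁) = 0` on `{ρ = 1}`.
[cite: TianYuanZhang2017, §1 (p0002 L101–L110), §3.1 (p0011 L27–L36), Lemma 3.18 (p0017 L152–L153)] [cite: SilvermanAEC2009, Prop. X.4.9] -/
theorem half_not_twoDivisible_of_rhoIndex_eq_two (hsq : Squarefree n) (hodd : Odd n) (hn1 : 1 < n) (D : GenusPointData n)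
    (h318 : D.lemma318) (hcomm : ∀ g h : D.H ≃ₐ[ℚ] D.H, g * h = h * g)
    (hrank : haveI := isElliptic_congruentNumberCurve hsq.ne_zero; (congruentNumberCurve n).mordellWeilRank = 1)
    (hρ : (rhoSubgroup n).index = 2)
    {R : (congruentNumberCurve n).toAffine.Point} (hR : ∀ x, ∃ k : ℤ, IsOfFinAddOrder (x - k • R))
    {Q₁ : APoint D.H} (hQ₁ : φH D Q₁ = Point.map (W' := curveA.twoIsogenyCodomain)
      (D.embK n (Nat.mem_divisors_self n hsq.ne_zero)) (ΘE hsq.ne_zero R)) :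
    ¬ ∃ y : APoint D.H, IsOfFinAddOrder (Q₁ - (2 : ℤ) • y) := by
  have h := not_fourDivisible_pow_smul_half hsq hodd hn1 D h318 hcomm hrank (ρ := 1) (by rw [pow_one]; exact hρ) hR hQ₁
  rintro ⟨y, hy⟩
  refine h ⟨y, ?_⟩
  have e : ((2 : ℤ) ^ 1) • Q₁ - (4 : ℤ) • y = (2 : ℤ) • (Q₁ - (2 : ℤ) • y) := by
    rw [pow_one, smul_sub, smul_smul]; norm_num
  rw [e]
  exact hy.zsmul

/-- **`ρ(n) = 0` ⟹ `Q₁ ∉ 4A(ℍ′_n) + tors`** (block-free family, rank one): the frozen half has depth `≤ 1` — law (D1′) of the lineage's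
R2 census (`Lines/offtyz_v7_GenusPeriodBit.md` §11: `depth α_n ∈ {0, 1}`, 117/117) as a THEOREM.
[cite: TianYuanZhang2017, §1 (p0002 L101–L110), §3.1 (p0011 L27–L36), Lemma 3.18 (p0017 L152–L153)] [cite: SilvermanAEC2009, Prop. X.4.9] -/
theorem half_not_fourDivisible_of_rhoIndex_eq_one (hsq : Squarefree n) (hodd : Odd n) (hn1 : 1 < n) (D : GenusPointData n)
    (h318 : D.lemma318) (hcomm : ∀ g h : D.H ≃ₐ[ℚ] D.H, g * h = h * g)
    (hrank : haveI := isElliptic_congruentNumberCurve hsq.ne_zero; (congruentNumberCurve n).mordellWeilRank = 1)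
    (hρ : (rhoSubgroup n).index = 1)
    {R : (congruentNumberCurve n).toAffine.Point} (hR : ∀ x, ∃ k : ℤ, IsOfFinAddOrder (x - k • R))
    {Q₁ : APoint D.H} (hQ₁ : φH D Q₁ = Point.map (W' := curveA.twoIsogenyCodomain)
      (D.embK n (Nat.mem_divisors_self n hsq.ne_zero)) (ΘE hsq.ne_zero R)) :
    ¬ ∃ y : APoint D.H, IsOfFinAddOrder (Q₁ - (4 : ℤ) • y) := by
  have h := not_fourDivisible_pow_smul_half hsq hodd hn1 D h318 hcomm hrank (ρ := 0) (by rw [pow_zero]; exact hρ) hR hQ₁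
  rwa [pow_zero, one_smul] at h

end Summit.BirchSwinnertonDyer.PrintCf2.GeneratorDepth

end
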